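import Literature.Geometry.Riemannian.TwistorChartGauge
import Literature.Geometry.Riemannian.TwistorFrames
import Literature.Geometry.Lorentzian.CurvatureNaturality
import HarnessLib

/-!
# The twistor space of an oriented Riemannian 4-manifold: transport of the coupling form to a chart

Support file (all results proved, no named facts) for `exists_twistorSpace_holds`
(`TwistorPackageProofs.lean`), step **T** of the construction: the minimal-coupling form
`couplingForm g ∇ e` of a twistor frame `e` on `M × S²` (`TwistorPackage.lean`) is, over the
source of a chart `ψ` of `M` contained in the domain of `e`, the pull-back along
`(x, ζ) ↦ (ψ x, ζ) ∈ ℝ⁴ × ℝ³` of the **model coupling form** `modelForm (chartConn G ê)`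
(`TwistorCouplingModel.lean`, `TwistorChartConnection.lean`) of the chart representatives
`G = metricRepr g hψ` of the metric and `ê a = fieldRepr ψ (e a)` of the frame
(`couplingForm_eq_pullback`). Ingredients:

* `TwistorChart.metric` — the metric transported to the chart target `ψ.target ⊆ ℝ⁴` along the
  inverse chart `Ψ` (a local isometry by construction; the `ℝ⁴`-copy of
  `Lorentzian/AtlasChartMetric.lean`), its representative `metricRepr` and the representative
  `fieldRepr ψ Y = dψ (Y ∘ ψ⁻¹)` of a vector field, with `Ψ^* Y = fieldRepr ψ Y`;
* naturality of the Levi-Civita connection and of the Riemann tensor under the local isometry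
  `Ψ` (`leviCivita_comap_mpullback_apply`, `riemann_comap_apply`, O'Neill 1983, Ch. 3,
  Prop. 3.59) and the coordinate formulas on the open set `ψ.target`
  (`OpensChart.leviCivita_apply_eq`, `riemann_eq_riemAt`): the connection and curvature vectors
  `selfDualConnectionVec`, `selfDualCurvatureVec` of the frame on `M` are the chart-level
  `chartConnVec`, `chartCurvVec` of the representatives (`selfDualConnectionVec_eq_chart`,
  `selfDualCurvatureVec_eq_chart`);
* the structure equation `modelCurv (chartConn G ê) = chartCurvVec G ê`
  (`modelCurv_chartConn`) and `|ζ|² = 1` turn `couplingBilin` into `modelScalar`;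
* invariance of `frameComplexStructure` / `frameTransition` / orthonormality / orientation under
  the linear isometries `dΨ_p` (`frameTransition_isometry`, …), so that the chart-level gauge data
  of two twistor frames (`chartTrans`, `TwistorChartGauge.lean`) are those of the frames on `M`;
* the model-level identities used by the assembly: gauge covariance of `modelForm` as an
  identity of alternating maps (`modelForm_gauge`), the antipodal symmetry
  `modelForm c (y, -η) ∘ (id × (-id)) = -modelForm c (y, η)` (`modelForm_antipode`) and the
  value on vertical pairs (`modelScalar_vertical`).

## References

* J. Fine, D. Panov, *Symplectic Calabi–Yau manifolds, minimal surfaces and the hyperbolic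
  geometry of the conifold*, J. Differential Geom. 82 (2009), §2.1, Prop. 2.1. [FinePanov2009]
* J. Fine, K. Krasnov, D. Panov, *A gauge theoretic approach to Einstein 4-manifolds*,
  New York J. Math. 20 (2014), §2.2, §4.1. [FineKrasnovPanov2014]
* B. O'Neill, *Semi-Riemannian geometry* (1983), Ch. 3, Prop. 3.13, Lemma 3.38, Prop. 3.59.
  [ONeill1983]
-/

noncomputable section

open Bundle Set Function Filter VectorField TopologicalSpace
open scoped Manifold ContDiff Topology Matrix BigOperators

namespace Literature.Geometry.Riemannian

open Literature.Geometry.Lorentzian (PseudoRiemannianMetric)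
open Literature.Geometry.Lorentzian.PseudoRiemannianMetric
open Literature.Geometry.Lorentzian.MetricCoord
open Literature.Geometry.Lorentzian
open Literature.Geometry.Kaehler (MForm)
open Literature.Topology.FourManifolds (SmoothOrientation)
open Literature.Topology.FourManifolds

/-- Local notation: the model space `ℝ⁴`. -/
local notation "E4" => EuclideanSpace ℝ (Fin 4)
/-- Local notation: `ℝ³` as a Euclidean space. -/
local notation "E3" => EuclideanSpace ℝ (Fin 3)
/-- Local notation: `ℝ²`, the model of the fibre sphere. -/
local notation "E2" => EuclideanSpace ℝ (Fin 2)
/-- Local notation: `ℝ³` as plain vectors. -/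
local notation "R3" => Fin 3 → ℝ
/-- Local notation: the unit 2-sphere in `ℝ³`. -/
local notation "𝕊²" => (Metric.sphere (0 : EuclideanSpace ℝ (Fin 3)) 1)

/-! ### Invariance of the frame algebra under linear isometries -/

section Isometry

variable {EM : Type*} [NormedAddCommGroup EM] [NormedSpace ℝ EM] {HM : Type*} [TopologicalSpace HM]
  {IM : ModelWithCorners ℝ EM HM} {M : Type*} [TopologicalSpace M] [ChartedSpace HM M]
  [IsManifold IM ∞ M] {nM : ℕ∞ω}
  {EN : Type*} [NormedAddCommGroup EN] [NormedSpace ℝ EN] {HN : Type*} [TopologicalSpace HN]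
  {IN : ModelWithCorners ℝ EN HN} {N : Type*} [TopologicalSpace N] [ChartedSpace HN N]
  [IsManifold IN ∞ N] {nN : ℕ∞ω}
  {gM : PseudoRiemannianMetric IM nM EM (TangentSpace IM : M → Type _)}
  {gN : PseudoRiemannianMetric IN nN EN (TangentSpace IN : N → Type _)}
  {x : M} {p : N} {L : TangentSpace IN p →L[ℝ] TangentSpace IM x}

/-- **`J_ζ` is natural under linear isometries**: for `L : T_pN → T_xM` with
`g_N(A, B) = g_M(LA, LB)`, `J^{g_M}_ζ(L ∘ e) ∘ L = L ∘ J^{g_N}_ζ(e)`. [folklore] -/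
theorem frameComplexStructure_isometry (hL : ∀ A B, gN.val p A B = gM.val x (L A) (L B))
    (e : Fin 4 → TangentSpace IN p) (ζ : R3) (v : TangentSpace IN p) :
    frameComplexStructure gM x (fun a ↦ L (e a)) ζ (L v) =
      L (frameComplexStructure gN p e ζ v) := by
  simp only [frameComplexStructure, FunLike.coe_sum, Finset.sum_apply, FunLike.coe_smul,
    Pi.smul_apply, selfDualPairs_eq, bivectorEnd_apply, map_sum, map_smul, map_sub, ← hL]

/-- **The frame transition map is natural under linear isometries**:
`frameTransition g_M x (L ∘ e) (L ∘ e') = frameTransition g_N p e e'`. [folklore] -/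
theorem frameTransition_isometry (hL : ∀ A B, gN.val p A B = gM.val x (L A) (L B))
    (e e' : Fin 4 → TangentSpace IN p) (ζ : R3) :
    frameTransition gM x (fun a ↦ L (e a)) (fun a ↦ L (e' a)) ζ = frameTransition gN p e e' ζ := by
  ext m
  rw [frameTransition_apply, frameTransition_apply, frameComplexStructure_isometry hL, ← hL]

/-- Linear isometries map orthonormal frames to orthonormal frames. [folklore] -/
theorem isOrthonormalFrame_isometry (hL : ∀ A B, gN.val p A B = gM.val x (L A) (L B))
    {ι : Type*} {e : ι → TangentSpace IN p} (he : gN.IsOrthonormalFrame p e) :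
    gM.IsOrthonormalFrame x (fun a ↦ L (e a)) :=
  ⟨fun i ↦ by rw [← hL]; exact he.1 i, fun i j hij ↦ by rw [← hL]; exact he.2 i j hij⟩

end Isometry

/-! ### Charts of `M` and the transported metric (the `ℝ⁴`-copy of `AtlasChartMetric`) -/

namespace TwistorChart

variable {M : Type*} [TopologicalSpace M] {ψ : OpenPartialHomeomorph M E4}

variable (ψ) in
/-- The target of the chart `ψ` as an open submanifold of `ℝ⁴`. [folklore] -/
abbrev target : Opens E4 :=
  ⟨ψ.target, ψ.open_target⟩

variable (ψ) in
/-- The inverse chart `Ψ : ψ.target → M`, `Ψ p = ψ⁻¹ p`. [folklore] -/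
def inv : target ψ → M :=
  fun p ↦ ψ.symm p

/-- Unfolding lemma: `inv ψ p = ψ⁻¹ p`. [folklore] -/
@[simp]
theorem inv_apply (p : target ψ) : inv ψ p = ψ.symm p := rfl

/-- The inverse chart lands in the chart source. [folklore] -/
theorem inv_mem_source (p : target ψ) : inv ψ p ∈ ψ.source :=
  ψ.map_target p.2

/-- `ψ (ψ⁻¹ p) = p` on the target. [folklore] -/
@[simp]
theorem apply_inv (p : target ψ) : ψ (inv ψ p) = p :=
  ψ.right_inv p.2

/-! ### The chart map `M × S² → ℝ⁴ × ℝ³` -/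

variable (ψ) in
/-- The chart map `(x, ζ) ↦ (ψ x, ζ) ∈ ℝ⁴ × ℝ³` of `M × S²`. [folklore] -/
def chartProd : M × 𝕊² → E4 × E3 :=
  fun q ↦ (ψ q.1, (q.2 : E3))

/-- Unfolding `chartProd`. [folklore] -/
@[simp] theorem chartProd_apply (q : M × 𝕊²) : chartProd ψ q = (ψ q.1, (q.2 : E3)) := rfl

/-- `|ζ|² = 1` on the sphere, in the dot-product form. [folklore] -/
theorem dotProduct_self_sphere (ζ : 𝕊²) :
    WithLp.ofLp (ζ : E3) ⬝ᵥ WithLp.ofLp (ζ : E3) = 1 := by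
  have h : ‖(ζ : E3)‖ = 1 := norm_eq_of_mem_sphere ζ
  have h2 : inner ℝ (ζ : E3) (ζ : E3) = 1 := by
    rw [real_inner_self_eq_norm_sq, h, one_pow]
  rwa [EuclideanSpace.inner_eq_star_dotProduct, star_trivial] at h2

/-- Instance: `dim ℝ³ = 2 + 1`, making the manifold structure `𝓡 2` of `𝕊²` available. [folklore] -/
instance instFactFinrankThree' : Fact (Module.finrank ℝ E3 = 2 + 1) := ⟨finrank_euclideanSpace_fin⟩

/-- **Tangent vectors of the sphere are orthogonal to the position vector**: `⟨ζ, dι_ζ w⟩ = 0`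
(Mathlib's `range_mfderiv_coe_sphere`). [folklore] -/
theorem dotProduct_mfderiv_coe_sphere (ζ : 𝕊²) (w : E2) :
    WithLp.ofLp (ζ : E3) ⬝ᵥ WithLp.ofLp ((mfderiv (𝓡 2) 𝓘(ℝ, E3) (Subtype.val : 𝕊² → E3) ζ :
      E2 →L[ℝ] E3) w) = 0 := by
  have hr := range_mfderiv_coe_sphere (n := 2) ζ
  have hmem : (mfderiv (𝓡 2) 𝓘(ℝ, E3) (Subtype.val : 𝕊² → E3) ζ : E2 →L[ℝ] E3) w ∈
      (Submodule.span ℝ {(ζ : E3)})ᗮ := by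
    rw [← hr]
    exact LinearMap.mem_range_self _ _
  have key : ∀ v : E3, v ∈ (Submodule.span ℝ {(ζ : E3)})ᗮ →
      WithLp.ofLp (ζ : E3) ⬝ᵥ WithLp.ofLp v = 0 := by
    intro v hv
    have h := (Submodule.mem_orthogonal_singleton_iff_inner_right (𝕜 := ℝ)).mp hv
    rwa [EuclideanSpace.inner_eq_star_dotProduct, star_trivial, dotProduct_comm] at h
  exact key _ hmem

/-- A vector of `ℝ³` orthogonal to `ζ ∈ S²` is a tangent vector of the sphere at `ζ`. [folklore] -/
theorem exists_mfderiv_coe_sphere_eq (ζ : 𝕊²) {b : E3}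
    (hb : WithLp.ofLp (ζ : E3) ⬝ᵥ WithLp.ofLp b = 0) :
    ∃ w : E2, (mfderiv (𝓡 2) 𝓘(ℝ, E3) (Subtype.val : 𝕊² → E3) ζ : E2 →L[ℝ] E3) w = b := by
  have hr := range_mfderiv_coe_sphere (n := 2) ζ
  have hmem : b ∈ (Submodule.span ℝ {(ζ : E3)})ᗮ := by
    refine (Submodule.mem_orthogonal_singleton_iff_inner_right (𝕜 := ℝ)).mpr ?_
    rw [EuclideanSpace.inner_eq_star_dotProduct, star_trivial, dotProduct_comm]
    exact hb
  rw [← hr] at hmem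
  exact hmem

variable [ChartedSpace E4 M]

/-- A chart of the maximal `C^∞` atlas is differentiable with differentiable inverse. [folklore] -/
theorem mdifferentiable_chart (hψ : ψ ∈ IsManifold.maximalAtlas (𝓡 4) ∞ M) :
    ψ.MDifferentiable (𝓡 4) (𝓡 4) :=
  ⟨(contMDiffOn_of_mem_maximalAtlas hψ).mdifferentiableOn (by simp),
    (contMDiffOn_symm_of_mem_maximalAtlas hψ).mdifferentiableOn (by simp)⟩

/-- The inverse chart is smooth (`C^{∞ + 1} = C^∞`). [folklore] -/
theorem contMDiff_inv (hψ : ψ ∈ IsManifold.maximalAtlas (𝓡 4) ∞ M) :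
    ContMDiff 𝓘(ℝ, E4) (𝓡 4) (∞ + 1) (inv ψ) := by
  have h : ((∞ : ℕ∞ω) + 1) = ∞ := rfl
  rw [h]
  exact (contMDiffOn_symm_of_mem_maximalAtlas hψ).comp_contMDiff contMDiff_subtype_val
    fun p ↦ p.2

/-- The inverse chart is smooth of class `C^∞`. [folklore] -/
theorem contMDiff_inv' (hψ : ψ ∈ IsManifold.maximalAtlas (𝓡 4) ∞ M) :
    ContMDiff 𝓘(ℝ, E4) (𝓡 4) ∞ (inv ψ) :=
  (contMDiff_inv hψ).of_le le_self_add

/-- The chart is smooth at the points of its source. [folklore] -/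
theorem contMDiffAt_chart (hψ : ψ ∈ IsManifold.maximalAtlas (𝓡 4) ∞ M) {x : M}
    (hx : x ∈ ψ.source) : ContMDiffAt (𝓡 4) 𝓘(ℝ, E4) ∞ ψ x :=
  (contMDiffOn_of_mem_maximalAtlas hψ).contMDiffAt (ψ.open_source.mem_nhds hx)

/-- The differential of the inverse chart from the open submanifold is the differential of
`ψ.symm`. [folklore] -/
theorem mfderiv_inv (hψ : ψ ∈ IsManifold.maximalAtlas (𝓡 4) ∞ M) (p : target ψ) :
    mfderiv 𝓘(ℝ, E4) (𝓡 4) (inv ψ) p = mfderiv 𝓘(ℝ, E4) (𝓡 4) ψ.symm (p : E4) := by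
  have hp : (p : E4) ∈ ψ.symm.source := p.2
  have hf : MDifferentiableAt 𝓘(ℝ, E4) (𝓡 4) ψ.symm (p : E4) :=
    (mdifferentiable_chart hψ).symm.mdifferentiableAt hp
  rw [show inv ψ = ψ.symm ∘ Subtype.val from rfl,
    mfderiv_comp p hf (Literature.Geometry.Manifold.OpenSubmanifold.mdifferentiableAt_subtype_val p),
    Literature.Geometry.Manifold.OpenSubmanifold.mfderiv_subtype_val]
  exact ContinuousLinearMap.comp_id _

/-- The differential of the inverse chart is invertible. [folklore] -/
theorem isInvertible_mfderiv_inv (hψ : ψ ∈ IsManifold.maximalAtlas (𝓡 4) ∞ M) (p : target ψ) :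
    (mfderiv 𝓘(ℝ, E4) (𝓡 4) (inv ψ) p).IsInvertible := by
  have hp : (p : E4) ∈ ψ.symm.source := p.2
  rw [mfderiv_inv hψ]
  exact ⟨(mdifferentiable_chart hψ).symm.mfderiv hp, rfl⟩

/-- The differential of the inverse chart is injective. [folklore] -/
theorem injective_mfderiv_inv (hψ : ψ ∈ IsManifold.maximalAtlas (𝓡 4) ∞ M) :
    ∀ p : target ψ, Function.Injective (mfderiv 𝓘(ℝ, E4) (𝓡 4) (inv ψ) p) := fun p ↦ by
  have hp : (p : E4) ∈ ψ.symm.source := p.2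
  rw [mfderiv_inv hψ]
  exact (mdifferentiable_chart hψ).symm.mfderiv_injective hp

/-- `dψ⁻¹_p (dψ_{ψ⁻¹ p} w) = w`. [folklore] -/
theorem mfderiv_symm_mfderiv (hψ : ψ ∈ IsManifold.maximalAtlas (𝓡 4) ∞ M) (p : target ψ)
    (w : E4) :
    mfderiv 𝓘(ℝ, E4) (𝓡 4) ψ.symm (p : E4) (mfderiv (𝓡 4) 𝓘(ℝ, E4) ψ (ψ.symm p) w) = w :=
  haveI hp : (p : E4) ∈ ψ.symm.source := p.2
  ((mdifferentiable_chart hψ).symm.mfderiv hp).apply_symm_apply w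

/-- `dψ_{ψ⁻¹ p} (dψ⁻¹_p v) = v`. [folklore] -/
theorem mfderiv_mfderiv_symm (hψ : ψ ∈ IsManifold.maximalAtlas (𝓡 4) ∞ M) (p : target ψ)
    (v : E4) :
    mfderiv (𝓡 4) 𝓘(ℝ, E4) ψ (ψ.symm p) (mfderiv 𝓘(ℝ, E4) (𝓡 4) ψ.symm (p : E4) v) = v :=
  haveI hp : (p : E4) ∈ ψ.symm.source := p.2
  ((mdifferentiable_chart hψ).symm.mfderiv hp).symm_apply_apply v

/-- `dψ⁻¹_{ψ x} (dψ_x u) = u` at a point of the source. [folklore] -/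
theorem mfderiv_symm_mfderiv' (hψ : ψ ∈ IsManifold.maximalAtlas (𝓡 4) ∞ M) {x : M}
    (hx : x ∈ ψ.source) (u : E4) :
    mfderiv 𝓘(ℝ, E4) (𝓡 4) ψ.symm (ψ x) (mfderiv (𝓡 4) 𝓘(ℝ, E4) ψ x u) = u :=
  ((mdifferentiable_chart hψ).mfderiv hx).symm_apply_apply u

/-! ### The chart representative of a vector field -/

variable (ψ) in
/-- **The chart representative of a vector field** `Y` on `M`: `ê(q) = dψ_{ψ⁻¹ q}(Y(ψ⁻¹ q))`, a
plain map `ℝ⁴ → ℝ⁴` (meaningful on `ψ.target`); it is the field `Ψ^* Y` on the target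
(`mpullback_inv_eq`). [folklore] -/
def fieldRepr (Y : Π y : M, TangentSpace (𝓡 4) y) : E4 → E4 :=
  fun q ↦ mfderiv (𝓡 4) 𝓘(ℝ, E4) ψ (ψ.symm q) (Y (ψ.symm q))

/-- `dΨ_p (fieldRepr ψ Y p) = Y (Ψ p)`. [folklore] -/
theorem mfderiv_inv_fieldRepr (hψ : ψ ∈ IsManifold.maximalAtlas (𝓡 4) ∞ M)
    (Y : Π y : M, TangentSpace (𝓡 4) y) (p : target ψ) :
    mfderiv 𝓘(ℝ, E4) (𝓡 4) (inv ψ) p (fieldRepr ψ Y p) = Y (ψ.symm p) := by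
  rw [mfderiv_inv hψ]
  exact mfderiv_symm_mfderiv hψ p _

/-- `Ψ^* Y = fieldRepr ψ Y` on the target. [folklore] -/
theorem mpullback_inv_eq (hψ : ψ ∈ IsManifold.maximalAtlas (𝓡 4) ∞ M)
    (Y : Π y : M, TangentSpace (𝓡 4) y) (p : target ψ) :
    mpullback 𝓘(ℝ, E4) (𝓡 4) (inv ψ) Y p = fieldRepr ψ Y p := by
  rw [mpullback_apply]
  have h : Y (inv ψ p) = mfderiv 𝓘(ℝ, E4) (𝓡 4) (inv ψ) p (fieldRepr ψ Y p) :=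
    (mfderiv_inv_fieldRepr hψ Y p).symm
  rw [h, (isInvertible_mfderiv_inv hψ p).inverse_apply_self]

omit [ChartedSpace E4 M] in
/-- At a point of the source, `fieldRepr ψ Y (ψ x) = dψ_x (Y x)`. [folklore] -/
theorem fieldRepr_apply_of_mem [ChartedSpace E4 M] (Y : Π y : M, TangentSpace (𝓡 4) y) {x : M}
    (hx : x ∈ ψ.source) :
    fieldRepr ψ Y (ψ x) = mfderiv (𝓡 4) 𝓘(ℝ, E4) ψ x (Y x) := by
  have key : ∀ {y : M}, y = x →
      (mfderiv (𝓡 4) 𝓘(ℝ, E4) ψ y (Y y) : E4) = mfderiv (𝓡 4) 𝓘(ℝ, E4) ψ x (Y x) := by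
    rintro _ rfl; rfl
  exact key (ψ.left_inv hx)

/-! ### The chart map `M × S² → ℝ⁴ × ℝ³`: smoothness and differential -/

/-- `HasMFDerivAt` for a pair of maps into normed spaces (the `HasMFDerivAt` version of
Mathlib's `MDifferentiableAt.prodMk_space`). [folklore] -/
theorem hasMFDerivAt_prodMk_space {N : Type*} [TopologicalSpace N] {H' : Type*}
    [TopologicalSpace H'] {E' : Type*} [NormedAddCommGroup E'] [NormedSpace ℝ E']
    {I' : ModelWithCorners ℝ E' H'} [ChartedSpace H' N]
    {F₁ : Type*} [NormedAddCommGroup F₁] [NormedSpace ℝ F₁]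
    {F₂ : Type*} [NormedAddCommGroup F₂] [NormedSpace ℝ F₂]
    {f₁ : N → F₁} {f₂ : N → F₂} {z : N} {d₁ : TangentSpace I' z →L[ℝ] F₁}
    {d₂ : TangentSpace I' z →L[ℝ] F₂}
    (h₁ : HasMFDerivAt I' 𝓘(ℝ, F₁) f₁ z d₁) (h₂ : HasMFDerivAt I' 𝓘(ℝ, F₂) f₂ z d₂) :
    HasMFDerivAt I' 𝓘(ℝ, F₁ × F₂) (fun y ↦ (f₁ y, f₂ y)) z (d₁.prod d₂) :=
  ⟨h₁.1.prodMk h₂.1, h₁.2.prodMk h₂.2⟩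

/-- The chart map is smooth at the points over the chart source. [folklore] -/
theorem contMDiffAt_chartProd (hψ : ψ ∈ IsManifold.maximalAtlas (𝓡 4) ∞ M) {q : M × 𝕊²}
    (hq : q.1 ∈ ψ.source) :
    ContMDiffAt ((𝓡 4).prod (𝓡 2)) 𝓘(ℝ, E4 × E3) ∞ (chartProd ψ) q :=
  ((contMDiffAt_chart hψ hq).comp q contMDiffAt_fst).prodMk_space
    ((contMDiff_coe_sphere (m := ∞) (n := 2) q.2).comp q contMDiffAt_snd)

/-- The chart map is smooth near the points over the chart source. [folklore] -/
theorem eventually_contMDiffAt_chartProd (hψ : ψ ∈ IsManifold.maximalAtlas (𝓡 4) ∞ M)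
    {q : M × 𝕊²} (hq : q.1 ∈ ψ.source) :
    ∀ᶠ q' in 𝓝 q, ContMDiffAt ((𝓡 4).prod (𝓡 2)) 𝓘(ℝ, E4 × E3) ∞ (chartProd ψ) q' := by
  have h : ∀ᶠ q' : M × 𝕊² in 𝓝 q, q'.1 ∈ ψ.source :=
    continuousAt_fst.preimage_mem_nhds (ψ.open_source.mem_nhds hq)
  exact h.mono fun q' hq' ↦ contMDiffAt_chartProd hψ hq'

/-- **The differential of the chart map**: `d(chartProd ψ)_{(x,ζ)}(u, w) = (dψ_x u, dι_ζ w)`.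
[folklore] -/
theorem mfderiv_chartProd_apply (hψ : ψ ∈ IsManifold.maximalAtlas (𝓡 4) ∞ M) {x : M}
    (hx : x ∈ ψ.source) (ζ : 𝕊²) (ξ : E4 × E2) :
    mfderiv ((𝓡 4).prod (𝓡 2)) 𝓘(ℝ, E4 × E3) (chartProd ψ) (x, ζ) ξ =
      (mfderiv (𝓡 4) 𝓘(ℝ, E4) ψ x ξ.1,
        (mfderiv (𝓡 2) 𝓘(ℝ, E3) (Subtype.val : 𝕊² → E3) ζ :
          EuclideanSpace ℝ (Fin 2) →L[ℝ] E3) ξ.2) := by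
  have h1 : HasMFDerivAt ((𝓡 4).prod (𝓡 2)) 𝓘(ℝ, E4) (fun q : M × 𝕊² ↦ ψ q.1) (x, ζ)
      ((mfderiv (𝓡 4) 𝓘(ℝ, E4) ψ x).comp
        (ContinuousLinearMap.fst ℝ (TangentSpace (𝓡 4) x) (TangentSpace (𝓡 2) ζ))) :=
    ((contMDiffAt_chart hψ hx).mdifferentiableAt (by simp)).hasMFDerivAt.comp (x, ζ)
      (hasMFDerivAt_fst (x, ζ))
  have h2 : HasMFDerivAt ((𝓡 4).prod (𝓡 2)) 𝓘(ℝ, E3) (fun q : M × 𝕊² ↦ (q.2 : E3)) (x, ζ)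
      ((mfderiv (𝓡 2) 𝓘(ℝ, E3) (Subtype.val : 𝕊² → E3) ζ).comp
        (ContinuousLinearMap.snd ℝ (TangentSpace (𝓡 4) x) (TangentSpace (𝓡 2) ζ))) :=
    ((contMDiff_coe_sphere (m := ∞) (n := 2) ζ).mdifferentiableAt (by simp)).hasMFDerivAt.comp
      (x, ζ) (hasMFDerivAt_snd (x, ζ))
  have h := (hasMFDerivAt_prodMk_space h1 h2).mfderiv
  rw [show chartProd ψ = fun q : M × 𝕊² ↦ (ψ q.1, (q.2 : E3)) from rfl, h]
  rfl

variable [IsManifold (𝓡 4) ∞ M]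

/-! ### The transported metric -/

variable (g : PseudoRiemannianMetric (𝓡 4) ∞ E4 (TangentSpace (𝓡 4) : M → Type _))

/-- **The metric transported to the chart target**: `Ψ^* g` on the open submanifold `ψ.target`
of `ℝ⁴` (`PseudoRiemannianMetric.comap` along the local diffeomorphism `Ψ = inv ψ`), a local
isometry `(ψ.target, Ψ^* g) → (M, g)` by construction (O'Neill 1983, Ch. 3, pp. 90–91).
[cite: ONeill1983, Ch. 3, pp. 90–91] -/
def metric (hψ : ψ ∈ IsManifold.maximalAtlas (𝓡 4) ∞ M) :
    PseudoRiemannianMetric 𝓘(ℝ, E4) ∞ E4 (TangentSpace 𝓘(ℝ, E4) : target ψ → Type _) :=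
  g.comap PseudoRiemannianMetric.contMDiff_pullbackBilin_holds (inv ψ) (contMDiff_inv hψ)
    (injective_mfderiv_inv hψ) rfl

/-- `(Ψ^* g)_p(a, b) = g_{Ψ p}(dΨ_p a, dΨ_p b)`. [cite: ONeill1983, Ch. 3, pp. 90–91] -/
@[simp]
theorem metric_val (hψ : ψ ∈ IsManifold.maximalAtlas (𝓡 4) ∞ M) (p : target ψ) (a b : E4) :
    (metric g hψ).val p a b =
      g.val (ψ.symm p) (mfderiv 𝓘(ℝ, E4) (𝓡 4) (inv ψ) p a)
        (mfderiv 𝓘(ℝ, E4) (𝓡 4) (inv ψ) p b) :=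
  rfl

/-- The representative of the transported metric (junk value `0` off the target). [folklore] -/
def metricRepr (hψ : ψ ∈ IsManifold.maximalAtlas (𝓡 4) ∞ M) : E4 → E4 →L[ℝ] E4 →L[ℝ] ℝ :=
  fun p ↦ by
    classical
    exact if hp : p ∈ ψ.target then (metric g hψ).val ⟨p, hp⟩ else 0

/-- The representative represents: `(Ψ^* g).val p = metricRepr p` on the target. [folklore] -/
theorem metric_val_eq_repr (hψ : ψ ∈ IsManifold.maximalAtlas (𝓡 4) ∞ M) :
    ∀ p : target ψ, (metric g hψ).val p = metricRepr g hψ p := fun p ↦ by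
  have hp : (p : E4) ∈ ψ.target := p.2
  simp only [metricRepr, dif_pos hp]

/-- The representative is a smooth nondegenerate symmetric form on the target
(`OpensChart.isMetricOn_repr`). [folklore] -/
theorem isMetricOn_metricRepr (hψ : ψ ∈ IsManifold.maximalAtlas (𝓡 4) ∞ M) :
    IsMetricOn (metricRepr g hψ) ψ.target :=
  OpensChart.isMetricOn_repr (metric_val_eq_repr g hψ)

/-! ### Smoothness of the chart representative of a vector field -/

variable {g}

/-- **The representative of a smooth field is smooth**: if `Y` is `C^∞` at `Ψ p` as a section of
`TM`, then `fieldRepr ψ Y` is `C^∞` at `p` (Mathlib's `ContMDiffAt.mpullback_vectorField_preimage`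
for the local diffeomorphism `Ψ`, read in the trivial chart of the open set `ψ.target`).
[folklore] -/
theorem contDiffAt_fieldRepr (hψ : ψ ∈ IsManifold.maximalAtlas (𝓡 4) ∞ M)
    {Y : Π y : M, TangentSpace (𝓡 4) y} (p : target ψ)
    (hY : ContMDiffAt (𝓡 4) (𝓡 4).tangent ∞
      (fun y ↦ (TotalSpace.mk' E4 y (Y y) : TangentBundle (𝓡 4) M)) (ψ.symm p)) :
    ContDiffAt ℝ ∞ (fieldRepr ψ Y) p := by
  have h1 : ContMDiffAt 𝓘(ℝ, E4) (𝓘(ℝ, E4).tangent) ∞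
      (fun q : target ψ ↦ (TotalSpace.mk' E4 q (mpullback 𝓘(ℝ, E4) (𝓡 4) (inv ψ) Y q) :
        TangentBundle 𝓘(ℝ, E4) (target ψ))) p :=
    ContMDiffAt.mpullback_vectorField_preimage hY (contMDiff_inv hψ p)
      (isInvertible_mfderiv_inv hψ p) le_rfl
  have h2 := (OpensChart.contMDiffAt_section_iff p _).1 h1
  exact (OpensChart.contMDiffAt_iff p _ (fieldRepr ψ Y) (mpullback_inv_eq hψ Y)).1 h2

/-- The representatives of the vectors of an orthonormal frame at `Ψ p` form an orthonormal
frame of the transported metric at `p`. [folklore] -/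
theorem isOrthonormalFrame_fieldRepr (hψ : ψ ∈ IsManifold.maximalAtlas (𝓡 4) ∞ M)
    {ι : Type*} {e : ι → Π y : M, TangentSpace (𝓡 4) y} (p : target ψ)
    (he : g.IsOrthonormalFrame (ψ.symm p) (fun a ↦ e a (ψ.symm p))) :
    (metric g hψ).IsOrthonormalFrame p (fun a ↦ fieldRepr ψ (e a) p) := by
  refine ⟨fun i ↦ ?_, fun i j hij ↦ ?_⟩
  · simp only [metric_val, mfderiv_inv_fieldRepr hψ]
    exact he.1 i
  · simp only [metric_val, mfderiv_inv_fieldRepr hψ]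
    exact he.2 i j hij

/-- **Like-oriented frames stay like-oriented in the chart**: for two frames positively oriented
for `o` at `Ψ p`, some alternating 4-form on `ℝ⁴` is positive on the product of their
representatives at `p` (the orientation character of `o` precomposed with `dΨ_p`). [folklore] -/
theorem exists_vol_pos_fieldRepr (hψ : ψ ∈ IsManifold.maximalAtlas (𝓡 4) ∞ M)
    (o : SmoothOrientation (𝓡 4) M) {e e' : Fin 4 → Π y : M, TangentSpace (𝓡 4) y}
    (p : target ψ)
    (he : o.IsPosFrame (ψ.symm p)
      (fun i ↦ e (Fin.cast finrank_euclideanSpace_fin i) (ψ.symm p)))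
    (he' : o.IsPosFrame (ψ.symm p)
      (fun i ↦ e' (Fin.cast finrank_euclideanSpace_fin i) (ψ.symm p))) :
    ∃ vol : E4 [⋀^Fin 4]→ₗ[ℝ] ℝ,
      0 < vol (fun a ↦ fieldRepr ψ (e a) p) * vol (fun a ↦ fieldRepr ψ (e' a) p) := by
  obtain ⟨vol, hvol⟩ := exists_alternating_pos_of_isPosFrame o (ψ.symm p)
  set L : E4 →ₗ[ℝ] E4 := (mfderiv 𝓘(ℝ, E4) (𝓡 4) (inv ψ) p).toLinearMap with hL
  refine ⟨vol.compLinearMap L, ?_⟩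
  have h := hvol (fun a ↦ e a (ψ.symm p)) (fun a ↦ e' a (ψ.symm p)) he he'
  have h1 : vol.compLinearMap L (fun a ↦ fieldRepr ψ (e a) p) = vol (fun a ↦ e a (ψ.symm p)) := by
    rw [AlternatingMap.compLinearMap_apply]
    congr 1
    funext a
    exact mfderiv_inv_fieldRepr hψ (e a) p
  have h2 : vol.compLinearMap L (fun a ↦ fieldRepr ψ (e' a) p) = vol (fun a ↦ e' a (ψ.symm p)) := by
    rw [AlternatingMap.compLinearMap_apply]
    congr 1
    funext a
    exact mfderiv_inv_fieldRepr hψ (e' a) p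
  rw [h1, h2]
  exact h

/-! ### The connection and the curvature of a field, computed in the chart -/

variable (g)

/-- `metricRepr p A B = g_{Ψ p}(dΨ_p A, dΨ_p B)` on the target. [folklore] -/
theorem metricRepr_apply (hψ : ψ ∈ IsManifold.maximalAtlas (𝓡 4) ∞ M) (p : target ψ) (A B : E4) :
    metricRepr g hψ p A B =
      g.val (ψ.symm p) (mfderiv 𝓘(ℝ, E4) (𝓡 4) (inv ψ) p A)
        (mfderiv 𝓘(ℝ, E4) (𝓡 4) (inv ψ) p B) := by
  rw [← metric_val_eq_repr g hψ p]
  rfl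

/-- **The Levi-Civita connection of a field read in the chart.** For fields `Y, Z` on `M` with `Y`
smooth at `Ψ p`: `G_p(Ẑ p, ∇̂_w Ŷ (p)) = g_{Ψ p}(Z, ∇^g_{dΨ_p w} Y)`, where `Ŷ = fieldRepr ψ Y`,
`G = metricRepr g hψ` and `∇̂_w Ŷ = DŶ w + Γ_G(w, Ŷ)` is the coordinate covariant derivative
(`covD`). Proof: `Ψ` is a local isometry, so `∇^{Ψ^*g}_w (Ψ^*Y) = (dΨ)⁻¹ ∇^g_{dΨ w} Y`
(O'Neill 1983, Ch. 3, Prop. 3.59), `Ψ^*Y = Ŷ`, and on the open set `ψ.target ⊆ ℝ⁴` the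
connection of `Ψ^*g` is `DŶ + Γ(Ŷ)` (O'Neill 1983, Ch. 3, Prop. 3.13).
[cite: ONeill1983, Ch. 3, Prop. 3.59 and Prop. 3.13] -/
theorem metricRepr_covD_fieldRepr [g.HasLeviCivita] (hψ : ψ ∈ IsManifold.maximalAtlas (𝓡 4) ∞ M)
    (p : target ψ) {Y : Π y : M, TangentSpace (𝓡 4) y} (Z : Π y : M, TangentSpace (𝓡 4) y)
    (hY : ContMDiffAt (𝓡 4) (𝓡 4).tangent ∞
      (fun y ↦ (TotalSpace.mk' E4 y (Y y) : TangentBundle (𝓡 4) M)) (ψ.symm p)) (w : E4) :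
    metricRepr g hψ p (fieldRepr ψ Z p) (covD (metricRepr g hψ) w (fieldRepr ψ Y) p) =
      g.val (ψ.symm p) (Z (ψ.symm p))
        (g.leviCivita Y (ψ.symm p) (mfderiv 𝓘(ℝ, E4) (𝓡 4) (inv ψ) p w)) := by
  haveI hLC : (metric g hψ).HasLeviCivita := (metric g hψ).hasLeviCivita
  haveI : (g.comap PseudoRiemannianMetric.contMDiff_pullbackBilin_holds (inv ψ) (contMDiff_inv hψ)
      (injective_mfderiv_inv hψ) rfl).HasLeviCivita := hLC
  have hG := metric_val_eq_repr g hψ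
  have hYd : MDifferentiableAt (𝓡 4) ((𝓡 4).prod 𝓘(ℝ, E4))
      (fun y ↦ (TotalSpace.mk' E4 y (Y y) : TangentBundle (𝓡 4) M)) (inv ψ p) :=
    hY.mdifferentiableAt (by simp)
  -- naturality of the Levi-Civita connection under the local isometry `Ψ`
  have key := g.leviCivita_comap_mpullback_apply PseudoRiemannianMetric.contMDiff_pullbackBilin_holds
    (contMDiff_inv hψ) (injective_mfderiv_inv hψ) rfl (u := p) hYd w
  -- the connection of the transported metric in coordinates
  have hYr : DifferentiableAt ℝ (fieldRepr ψ Y) p :=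
    (contDiffAt_fieldRepr hψ p hY).differentiableAt (by simp)
  have hcoord := OpensChart.leviCivita_apply_eq hG p (W := mpullback 𝓘(ℝ, E4) (𝓡 4) (inv ψ) Y)
    (Wf := fieldRepr ψ Y) (mpullback_inv_eq hψ Y) hYr w
  rw [OpensChart.christoffel_eq_chrAt hG p, mpullback_inv_eq hψ Y p] at hcoord
  change (metric g hψ).leviCivita _ p w = _ at key
  have hcov : covD (metricRepr g hψ) w (fieldRepr ψ Y) p =
      (mfderiv 𝓘(ℝ, E4) (𝓡 4) (inv ψ) p).inverse
        (g.leviCivita Y (ψ.symm p) (mfderiv 𝓘(ℝ, E4) (𝓡 4) (inv ψ) p w)) := by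
    rw [covD_apply, ← hcoord]
    exact key
  rw [metricRepr_apply, mfderiv_inv_fieldRepr hψ, hcov,
    (isInvertible_mfderiv_inv hψ p).self_apply_inverse]

/-- **The Riemann tensor read in the chart**:
`G_p(riemAt G p û v̂ (Ŷ p), Ẑ p) = g_{Ψ p}(R^g(dΨ û, dΨ v̂) Y, Z)` — naturality of the Riemann
tensor under the local isometry `Ψ` (O'Neill 1983, Ch. 3, Prop. 3.59) and
`R^{Ψ^*g} = riemAt G` on the open set `ψ.target` (O'Neill 1983, Ch. 3, Lemma 3.38).
[cite: ONeill1983, Ch. 3, Prop. 3.59 and Lemma 3.38] -/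
theorem metricRepr_riemAt_fieldRepr [g.HasLeviCivita] (hψ : ψ ∈ IsManifold.maximalAtlas (𝓡 4) ∞ M)
    (p : target ψ) (Y Z : Π y : M, TangentSpace (𝓡 4) y) (a b : E4) :
    metricRepr g hψ p (riemAt (metricRepr g hψ) p a b (fieldRepr ψ Y p)) (fieldRepr ψ Z p) =
      g.val (ψ.symm p)
        (g.riemann (ψ.symm p) (mfderiv 𝓘(ℝ, E4) (𝓡 4) (inv ψ) p a)
          (mfderiv 𝓘(ℝ, E4) (𝓡 4) (inv ψ) p b) (Y (ψ.symm p)))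
        (Z (ψ.symm p)) := by
  haveI hLC : (metric g hψ).HasLeviCivita := (metric g hψ).hasLeviCivita
  haveI : (g.comap PseudoRiemannianMetric.contMDiff_pullbackBilin_holds (inv ψ) (contMDiff_inv hψ)
      (injective_mfderiv_inv hψ) rfl).HasLeviCivita := hLC
  have hG := metric_val_eq_repr g hψ
  have key := g.riemann_comap_apply PseudoRiemannianMetric.contMDiff_pullbackBilin_holds
    (contMDiff_inv hψ) (injective_mfderiv_inv hψ) rfl p a b (fieldRepr ψ Y p)
  change (metric g hψ).riemann p a b _ = _ at key
  rw [mfderiv_inv_fieldRepr hψ] at key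
  rw [← OpensChart.riemann_eq_riemAt hG p, metricRepr_apply, mfderiv_inv_fieldRepr hψ, key,
    (isInvertible_mfderiv_inv hψ p).self_apply_inverse]
  rfl

/-! ### The connection and curvature vectors of a frame are those of its representative -/

variable {g} {o : SmoothOrientation (𝓡 4) M}

/-- The representatives of the vector fields of a twistor frame are smooth on the target of a
chart whose source lies in the domain of the frame. [folklore] -/
theorem contDiffOn_fieldRepr_frame (hψ : ψ ∈ IsManifold.maximalAtlas (𝓡 4) ∞ M)
    (F : TwistorFrame g o) (hF : ψ.source ⊆ F.U) (a : Fin 4) :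
    ContDiffOn ℝ ∞ (fieldRepr ψ (F.frame a)) ψ.target := fun q hq ↦
  (contDiffAt_fieldRepr hψ ⟨q, hq⟩
    (F.contMDiffAt_frame (hF (ψ.map_target hq)) a)).contDiffWithinAt

/-- The representatives of a twistor frame form an orthonormal frame of the transported metric
on the target. [folklore] -/
theorem isOrthonormalFrame_fieldRepr_frame (hψ : ψ ∈ IsManifold.maximalAtlas (𝓡 4) ∞ M)
    (F : TwistorFrame g o) (hF : ψ.source ⊆ F.U) (p : target ψ) :
    (metric g hψ).IsOrthonormalFrame p (fun a ↦ fieldRepr ψ (F.frame a) p) :=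
  isOrthonormalFrame_fieldRepr hψ p (F.isOrthonormalFrame _ (hF (ψ.map_target p.2)))

/-- **The connection vector of a twistor frame is the chart connection vector of its
representative**: `c(u) = chartConnVec G ê (ψ x) (dψ_x u)` at the points of the chart source
(`metricRepr_covD_fieldRepr` termwise). [cite: FinePanov2009, §2.1] -/
theorem selfDualConnectionVec_eq_chart [g.HasLeviCivita]
    (hψ : ψ ∈ IsManifold.maximalAtlas (𝓡 4) ∞ M) (F : TwistorFrame g o) (hF : ψ.source ⊆ F.U)
    {x : M} (hx : x ∈ ψ.source) (u : TangentSpace (𝓡 4) x) :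
    selfDualConnectionVec g g.leviCivita F.frame x u =
      chartConnVec (metricRepr g hψ) (fun a ↦ fieldRepr ψ (F.frame a)) (ψ x)
        (mfderiv (𝓡 4) 𝓘(ℝ, E4) ψ x u) := by
  set p : target ψ := ⟨ψ x, ψ.map_source hx⟩ with hp
  have hxp : ψ.symm p = x := ψ.left_inv hx
  have hterm : ∀ a b : Fin 4,
      metricRepr g hψ p (fieldRepr ψ (F.frame b) p)
          (covD (metricRepr g hψ) (mfderiv (𝓡 4) 𝓘(ℝ, E4) ψ x u) (fieldRepr ψ (F.frame a)) p) =
        g.val x (F.frame b x) (g.leviCivita (F.frame a) x u) := by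
    intro a b
    have hY : ContMDiffAt (𝓡 4) (𝓡 4).tangent ∞
        (fun y ↦ (TotalSpace.mk' E4 y (F.frame a y) : TangentBundle (𝓡 4) M)) (ψ.symm p) := by
      rw [hxp]; exact F.contMDiffAt_frame (hF hx) a
    rw [metricRepr_covD_fieldRepr g hψ p (F.frame b) hY, mfderiv_inv hψ]
    have key : ∀ {y : M} (hy : y = x) (w : TangentSpace (𝓡 4) y), w = u →
        g.val y (F.frame b y) (g.leviCivita (F.frame a) y w) =
          g.val x (F.frame b x) (g.leviCivita (F.frame a) x u) := by
      rintro _ rfl _ rfl; rfl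
    exact key hxp _ (mfderiv_symm_mfderiv' hψ hx u)
  ext i
  simp only [selfDualConnectionVec, chartConnVec]
  exact Finset.sum_congr rfl fun k _ ↦ (hterm _ _).symm

/-- **The curvature vector of a twistor frame is the chart curvature vector of its
representative**: `Φ(u, v) = chartCurvVec G ê (ψ x) (dψ_x u) (dψ_x v)` at the points of the
chart source (`metricRepr_riemAt_fieldRepr` termwise). [cite: FineKrasnovPanov2014, §2.2] -/
theorem selfDualCurvatureVec_eq_chart [g.HasLeviCivita]
    (hψ : ψ ∈ IsManifold.maximalAtlas (𝓡 4) ∞ M) (F : TwistorFrame g o)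
    {x : M} (hx : x ∈ ψ.source) (u v : TangentSpace (𝓡 4) x) :
    selfDualCurvatureVec g g.leviCivita x (F.fr x) u v =
      chartCurvVec (metricRepr g hψ) (fun a ↦ fieldRepr ψ (F.frame a)) (ψ x)
        (mfderiv (𝓡 4) 𝓘(ℝ, E4) ψ x u) (mfderiv (𝓡 4) 𝓘(ℝ, E4) ψ x v) := by
  set p : target ψ := ⟨ψ x, ψ.map_source hx⟩ with hp
  have hxp : ψ.symm p = x := ψ.left_inv hx
  have hterm : ∀ a b : Fin 4,
      metricRepr g hψ p (riemAt (metricRepr g hψ) p (mfderiv (𝓡 4) 𝓘(ℝ, E4) ψ x u)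
          (mfderiv (𝓡 4) 𝓘(ℝ, E4) ψ x v) (fieldRepr ψ (F.frame a) p)) (fieldRepr ψ (F.frame b) p) =
        g.curvatureForm g.leviCivita x u v (F.frame a x) (F.frame b x) := by
    intro a b
    rw [metricRepr_riemAt_fieldRepr g hψ p, mfderiv_inv hψ]
    unfold PseudoRiemannianMetric.curvatureForm
    have key : ∀ {y : M} (hy : y = x) (w w' : TangentSpace (𝓡 4) y), w = u → w' = v →
        g.val y (g.riemann y w w' (F.frame a y)) (F.frame b y) =
          g.val x (g.leviCivita.curvature x u v (F.frame a x)) (F.frame b x) := by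
      rintro _ rfl _ _ rfl rfl; rfl
    exact key hxp _ _ (mfderiv_symm_mfderiv' hψ hx u) (mfderiv_symm_mfderiv' hψ hx v)
  ext i
  simp only [selfDualCurvatureVec, chartCurvVec, selfDualPairs_eq]
  exact Finset.sum_congr rfl fun k _ ↦ (hterm _ _).symm

/-! ### The coupling form of a frame is the pull-back of the model coupling form -/

/-- **The model coupling form of a twistor frame in a chart**: the model form
`modelForm (chartConn G ê)` of the chart representatives `G = metricRepr g hψ`,
`ê a = fieldRepr ψ (e a)`, as a `2`-form on the flat manifold `ℝ⁴ × ℝ³`.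
[cite: FinePanov2009, Prop. 2.1] -/
def modelFormOf (hψ : ψ ∈ IsManifold.maximalAtlas (𝓡 4) ∞ M) (F : TwistorFrame g o) :
    MForm 𝓘(ℝ, E4 × E3) (E4 × E3) ℝ 2 :=
  modelForm (chartConn (metricRepr g hψ) (fun a ↦ fieldRepr ψ (F.frame a)))

/-- Unfolding `modelFormOf`. [folklore] -/
theorem modelFormOf_apply (hψ : ψ ∈ IsManifold.maximalAtlas (𝓡 4) ∞ M) (F : TwistorFrame g o)
    (q : E4 × E3) :
    modelFormOf hψ F q = modelForm (chartConn (metricRepr g hψ) (fun a ↦ fieldRepr ψ (F.frame a))) q :=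
  rfl

/-- **The coupling form of a twistor frame is the pull-back of the model coupling form along the
chart map.** For a chart `ψ` of the maximal atlas with source in the domain of the twistor frame
`F`, at every `(x, ζ)` with `x ∈ ψ.source`:
`Ω_F(x, ζ) = (chartProd ψ)^* (modelForm (chartConn G ê)) (x, ζ)`, where `G`, `ê` are the chart
representatives of `g` and of the frame. Both sides are `(2π)⁻¹(⟨ζ, θ₁ × θ₂⟩ - ⟨ζ, Φ⟩)`: the
connection vectors agree (`selfDualConnectionVec_eq_chart`), the curvature vectors agree
(`selfDualCurvatureVec_eq_chart`) and `Φ̂ = dĉ + ĉ × ĉ` is the curvature vector (structure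
equation `modelCurv_chartConn`), `|ζ| = 1`. [cite: FinePanov2009, Prop. 2.1] -/
theorem couplingForm_eq_pullback [g.HasLeviCivita] (hψ : ψ ∈ IsManifold.maximalAtlas (𝓡 4) ∞ M)
    (F : TwistorFrame g o) (hF : ψ.source ⊆ F.U) {x : M} (hx : x ∈ ψ.source) (ζ : 𝕊²) :
    couplingForm g g.leviCivita F.frame (x, ζ) =
      (modelFormOf hψ F).pullback ((𝓡 4).prod (𝓡 2)) (chartProd ψ) (x, ζ) := by
  set G := metricRepr g hψ with hGdef
  set ê : Fin 4 → E4 → E4 := fun a ↦ fieldRepr ψ (F.frame a) with hê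
  have hG := metric_val_eq_repr g hψ
  set p : target ψ := ⟨ψ x, ψ.map_source hx⟩ with hp
  -- the structure equation at `ψ x`
  have hcurv : ∀ u v : E4, modelCurv (chartConn G ê) (ψ x) (mfderiv (𝓡 4) 𝓘(ℝ, E4) ψ x u)
      (mfderiv (𝓡 4) 𝓘(ℝ, E4) ψ x v) = selfDualCurvatureVec g g.leviCivita x (F.fr x) u v := by
    intro u v
    rw [selfDualCurvatureVec_eq_chart hψ F hx]
    exact modelCurv_chartConn hG finrank_euclideanSpace_fin (contDiffOn_fieldRepr_frame hψ F hF)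
      (isOrthonormalFrame_fieldRepr_frame hψ F hF) p _ _
  have hconn : ∀ u : E4, chartConn G ê (ψ x) (mfderiv (𝓡 4) 𝓘(ℝ, E4) ψ x u) =
      selfDualConnectionVec g g.leviCivita F.frame x u := fun u ↦ by
    rw [chartConn_apply, selfDualConnectionVec_eq_chart hψ F hF hx]
  -- the differential of the chart map, as a map into `ℝ⁴ × ℝ³`
  set D : (E4 × E2) → E4 × E3 :=
    fun ξ ↦ mfderiv ((𝓡 4).prod (𝓡 2)) 𝓘(ℝ, E4 × E3) (chartProd ψ) (x, ζ) ξ with hDdef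
  have hD : ∀ ξ : E4 × E2, D ξ = (mfderiv (𝓡 4) 𝓘(ℝ, E4) ψ x ξ.1,
      (mfderiv (𝓡 2) 𝓘(ℝ, E3) (Subtype.val : 𝕊² → E3) ζ : E2 →L[ℝ] E3) ξ.2) :=
    fun ξ ↦ mfderiv_chartProd_apply hψ hx ζ ξ
  have main : ∀ ξ₁ ξ₂ : E4 × E2, couplingBilin g g.leviCivita F.frame x ζ ξ₁ ξ₂ =
      modelScalar (chartConn G ê) (ψ x, (ζ : E3)) (D ξ₁) (D ξ₂) := by
    intro ξ₁ ξ₂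
    rw [couplingBilin_apply, couplingTheta_apply, couplingTheta_apply, hD, hD]
    simp only [modelScalar, modelTheta]
    rw [dotProduct_self_sphere, one_mul, hcurv, hconn, hconn]
  ext v
  have hR : (modelFormOf hψ F).pullback ((𝓡 4).prod (𝓡 2)) (chartProd ψ) (x, ζ) v =
      modelScalar (chartConn G ê) (ψ x, (ζ : E3)) (D (v 0)) (D (v 1)) :=
    modelForm_apply' (chartConn G ê) (ψ x, (ζ : E3)) (fun i ↦ D (v i))
  have hL : couplingForm g g.leviCivita F.frame (x, ζ) v =
      couplingBilin g g.leviCivita F.frame x ζ (v 0) (v 1) := by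
    conv_lhs => rw [eq_vecCons_two v]
    exact couplingAlt_apply' g g.leviCivita F.frame x ζ (v 0) (v 1)
  rw [hR, hL, main]

/-- `couplingForm_eq_pullback` at a point `q` of `M × S²` over the chart source.
[cite: FinePanov2009, Prop. 2.1] -/
theorem couplingForm_eq_pullback' [g.HasLeviCivita] (hψ : ψ ∈ IsManifold.maximalAtlas (𝓡 4) ∞ M)
    (F : TwistorFrame g o) (hF : ψ.source ⊆ F.U) {q : M × 𝕊²} (hq : q.1 ∈ ψ.source) :
    couplingForm g g.leviCivita F.frame q =
      (modelFormOf hψ F).pullback ((𝓡 4).prod (𝓡 2)) (chartProd ψ) q := by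
  obtain ⟨x, ζ⟩ := q
  exact couplingForm_eq_pullback hψ F hF hq ζ

omit [IsManifold (𝓡 4) ∞ M] in
/-- The differential of the chart map at a point `q` over the chart source. [folklore] -/
theorem mfderiv_chartProd_apply' (hψ : ψ ∈ IsManifold.maximalAtlas (𝓡 4) ∞ M) {q : M × 𝕊²}
    (hq : q.1 ∈ ψ.source) (ξ : E4 × E2) :
    mfderiv ((𝓡 4).prod (𝓡 2)) 𝓘(ℝ, E4 × E3) (chartProd ψ) q ξ =
      (mfderiv (𝓡 4) 𝓘(ℝ, E4) ψ q.1 ξ.1,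
        (mfderiv (𝓡 2) 𝓘(ℝ, E3) (Subtype.val : 𝕊² → E3) q.2 :
          EuclideanSpace ℝ (Fin 2) →L[ℝ] E3) ξ.2) := by
  obtain ⟨x, ζ⟩ := q
  exact mfderiv_chartProd_apply hψ hq ζ ξ

/-! ### Smoothness and closedness of the model coupling form of a frame -/

/-- In the flat case the chart representative of a form is the form. [folklore] -/
theorem inChart_eq_self_flat {V : Type*} [NormedAddCommGroup V] [NormedSpace ℝ V] {k : ℕ}
    (α : MForm 𝓘(ℝ, V) V ℝ k) (r : V) : α.inChart r = α := by
  funext y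
  ext v
  simp [MForm.inChart_apply]
  rfl

/-- In the flat case a form is smooth at a point where it is `C^∞` as a plain map. [folklore] -/
theorem smoothAt_of_contDiffAt_flat {V : Type*} [NormedAddCommGroup V] [NormedSpace ℝ V] {k : ℕ}
    {f : V → V [⋀^Fin k]→L[ℝ] ℝ} {r : V} (h : ContDiffAt ℝ ∞ f r) :
    MForm.SmoothAt (I := 𝓘(ℝ, V)) f r := by
  rw [MForm.SmoothAt, inChart_eq_self_flat]
  simp only [modelWithCornersSelf_coe, range_id, extChartAt_self_apply]
  exact h.contDiffWithinAt

/-- The chart connection form of a twistor frame is smooth on the chart target. [folklore] -/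
theorem contDiffOn_chartConn_frame (hψ : ψ ∈ IsManifold.maximalAtlas (𝓡 4) ∞ M)
    (F : TwistorFrame g o) (hF : ψ.source ⊆ F.U) :
    ContDiffOn ℝ ∞ (chartConn (metricRepr g hψ) (fun a ↦ fieldRepr ψ (F.frame a))) ψ.target :=
  contDiffOn_chartConn (isMetricOn_metricRepr g hψ) (contDiffOn_fieldRepr_frame hψ F hF)

/-- **The model coupling form of a frame is smooth** at the points over the chart target.
[cite: FinePanov2009, Prop. 2.1] -/
theorem smoothAt_modelFormOf (hψ : ψ ∈ IsManifold.maximalAtlas (𝓡 4) ∞ M)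
    (F : TwistorFrame g o) (hF : ψ.source ⊆ F.U) {r : E4 × E3} (hr : r.1 ∈ ψ.target) :
    (modelFormOf hψ F).SmoothAt r := by
  refine smoothAt_of_contDiffAt_flat ?_
  obtain ⟨q, η⟩ := r
  exact contDiffAt_modelForm ψ.open_target (contDiffOn_chartConn_frame hψ F hF) hr η

/-- **The model coupling form of a frame is closed on tangent triples of `ψ.target × S²`**
(`extDeriv_modelForm_apply_eq_zero` read through `mextDeriv = extDeriv` on the flat model).
[cite: FinePanov2009, Prop. 2.1] -/
theorem mextDeriv_modelFormOf_apply_eq_zero (hψ : ψ ∈ IsManifold.maximalAtlas (𝓡 4) ∞ M)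
    (F : TwistorFrame g o) (hF : ψ.source ⊆ F.U) {r : E4 × E3} (hr : r.1 ∈ ψ.target)
    (hη : WithLp.ofLp r.2 ⬝ᵥ WithLp.ofLp r.2 = 1) (X : Fin 3 → E4 × E3)
    (hX : ∀ i, WithLp.ofLp r.2 ⬝ᵥ WithLp.ofLp (X i).2 = 0) :
    Literature.Geometry.Kaehler.mextDeriv (modelFormOf hψ F) r X = 0 := by
  obtain ⟨q, η⟩ := r
  rw [Literature.Geometry.Kaehler.mextDeriv_eq_extDeriv]
  exact extDeriv_modelForm_apply_eq_zero ψ.open_target (contDiffOn_chartConn_frame hψ F hF) hr hη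
    X hX

/-! ### The transition map between the chart models of two frames -/

/-- **The transition map between the chart models of two twistor frames** `F₁, F₂` (chart `ψ`
with source in both domains): `(q, η) ↦ (q, T(q) η)` with
`T = chartTrans G ê₂ ê₁` — so that `J_η(ê₁) = J_{T η}(ê₂)`: it sends the `F₁`-coordinate of a
point of the twistor space to its `F₂`-coordinate (`transMap_apply_of_mem`).
[cite: AtiyahHitchinSinger1978, §4] -/
def transMap (hψ : ψ ∈ IsManifold.maximalAtlas (𝓡 4) ∞ M) (F₁ F₂ : TwistorFrame g o) :
    E4 × E3 → E4 × E3 :=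
  fun r ↦ (r.1, WithLp.toLp 2 (chartTrans (metricRepr g hψ) (fun a ↦ fieldRepr ψ (F₂.frame a))
    (fun a ↦ fieldRepr ψ (F₁.frame a)) r.1 (WithLp.ofLp r.2)))

/-- Unfolding `transMap`. [folklore] -/
theorem transMap_apply (hψ : ψ ∈ IsManifold.maximalAtlas (𝓡 4) ∞ M) (F₁ F₂ : TwistorFrame g o)
    (r : E4 × E3) :
    transMap hψ F₁ F₂ r = (r.1, WithLp.toLp 2 (chartTrans (metricRepr g hψ)
      (fun a ↦ fieldRepr ψ (F₂.frame a)) (fun a ↦ fieldRepr ψ (F₁.frame a)) r.1 (WithLp.ofLp r.2))) :=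
  rfl

/-- **The chart transition map is the frame transition map of the frames on `M`**: at a point of
the chart source, `T(ψ x) = frameTransition g x (e₂ x) (e₁ x)` (`chartTrans_eq` for the
transported metric, and naturality of `frameTransition` under the linear isometry `dΨ`).
[cite: AtiyahHitchinSinger1978, §1] -/
theorem chartTrans_apply_of_mem (hψ : ψ ∈ IsManifold.maximalAtlas (𝓡 4) ∞ M)
    (F₁ F₂ : TwistorFrame g o) {x : M} (hx : x ∈ ψ.source) (ζ : R3) :
    chartTrans (metricRepr g hψ) (fun a ↦ fieldRepr ψ (F₂.frame a))
        (fun a ↦ fieldRepr ψ (F₁.frame a)) (ψ x) ζ =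
      frameTransition g x (F₂.fr x) (F₁.fr x) ζ := by
  set p : target ψ := ⟨ψ x, ψ.map_source hx⟩ with hp
  have hG := metric_val_eq_repr g hψ
  have h1 := chartTrans_eq (ê := fun a ↦ fieldRepr ψ (F₂.frame a))
    (ê' := fun a ↦ fieldRepr ψ (F₁.frame a)) hG p ζ
  rw [show ((p : target ψ) : E4) = ψ x from rfl] at h1
  rw [h1]
  have hL : ∀ A B, (metric g hψ).val p A B =
      g.val (inv ψ p) (mfderiv 𝓘(ℝ, E4) (𝓡 4) (inv ψ) p A)
        (mfderiv 𝓘(ℝ, E4) (𝓡 4) (inv ψ) p B) := fun A B ↦ rfl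
  have h2 := frameTransition_isometry hL (fun a ↦ fieldRepr ψ (F₂.frame a) p)
    (fun a ↦ fieldRepr ψ (F₁.frame a) p) ζ
  rw [← h2]
  simp only [mfderiv_inv_fieldRepr hψ]
  have key : ∀ {y : M}, y = x →
      frameTransition g y (fun a ↦ F₂.frame a y) (fun a ↦ F₁.frame a y) ζ =
        frameTransition g x (F₂.fr x) (F₁.fr x) ζ := by
    rintro _ rfl; rfl
  exact key (ψ.left_inv hx)

/-- The transition map at a point over the chart source: `F₁`-coordinates go to `F₂`-coordinates,
`(ψ x, ζ) ↦ (ψ x, frameTransition g x (e₂ x) (e₁ x) ζ)`. [cite: AtiyahHitchinSinger1978, §4] -/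
theorem transMap_apply_of_mem (hψ : ψ ∈ IsManifold.maximalAtlas (𝓡 4) ∞ M)
    (F₁ F₂ : TwistorFrame g o) {x : M} (hx : x ∈ ψ.source) (η : E3) :
    transMap hψ F₁ F₂ (ψ x, η) =
      (ψ x, WithLp.toLp 2 (frameTransition g x (F₂.fr x) (F₁.fr x) (WithLp.ofLp η))) := by
  rw [transMap_apply, chartTrans_apply_of_mem hψ F₁ F₂ hx]

/-- The chart transition map `T` is smooth on the chart target. [folklore] -/
theorem contDiffOn_chartTrans_frame (hψ : ψ ∈ IsManifold.maximalAtlas (𝓡 4) ∞ M)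
    (F₁ F₂ : TwistorFrame g o) (hF₁ : ψ.source ⊆ F₁.U) (hF₂ : ψ.source ⊆ F₂.U) :
    ContDiffOn ℝ ∞ (chartTrans (metricRepr g hψ) (fun a ↦ fieldRepr ψ (F₂.frame a))
      (fun a ↦ fieldRepr ψ (F₁.frame a))) ψ.target :=
  contDiffOn_chartTrans (isMetricOn_metricRepr g hψ) (contDiffOn_fieldRepr_frame hψ F₂ hF₂)
    (contDiffOn_fieldRepr_frame hψ F₁ hF₁)

/-- **The differential of the transition map**: at `r = (q, η)` with `q ∈ ψ.target`,
`D(transMap)_r (u, w) = (u, (D_u T)(q) η + T(q) w)`. [folklore] -/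
theorem hasFDerivAt_transMap (hψ : ψ ∈ IsManifold.maximalAtlas (𝓡 4) ∞ M)
    (F₁ F₂ : TwistorFrame g o) (hF₁ : ψ.source ⊆ F₁.U) (hF₂ : ψ.source ⊆ F₂.U) {r : E4 × E3}
    (hr : r.1 ∈ ψ.target) :
    HasFDerivAt (transMap hψ F₁ F₂)
      ((ContinuousLinearMap.fst ℝ E4 E3).prod
        (((EuclideanSpace.equiv (Fin 3) ℝ).symm : R3 →L[ℝ] E3).comp
          (((fderiv ℝ (chartTrans (metricRepr g hψ) (fun a ↦ fieldRepr ψ (F₂.frame a))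
              (fun a ↦ fieldRepr ψ (F₁.frame a))) r.1).flip (WithLp.ofLp r.2)).comp
              (ContinuousLinearMap.fst ℝ E4 E3) +
            (chartTrans (metricRepr g hψ) (fun a ↦ fieldRepr ψ (F₂.frame a))
              (fun a ↦ fieldRepr ψ (F₁.frame a)) r.1).comp
              ((EuclideanSpace.equiv (Fin 3) ℝ : E3 →L[ℝ] R3).comp
                (ContinuousLinearMap.snd ℝ E4 E3))))) r := by
  set T := chartTrans (metricRepr g hψ) (fun a ↦ fieldRepr ψ (F₂.frame a))
    (fun a ↦ fieldRepr ψ (F₁.frame a)) with hT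
  have hTd : DifferentiableAt ℝ T r.1 :=
    (((contDiffOn_chartTrans_frame hψ F₁ F₂ hF₁ hF₂) r.1 hr).contDiffAt
      (ψ.open_target.mem_nhds hr)).differentiableAt (by simp)
  have h1 : HasFDerivAt (fun r' : E4 × E3 ↦ T r'.1) ((fderiv ℝ T r.1).comp
      (ContinuousLinearMap.fst ℝ E4 E3)) r :=
    hTd.hasFDerivAt.comp r hasFDerivAt_fst
  have h2 : HasFDerivAt (fun r' : E4 × E3 ↦ WithLp.ofLp r'.2)
      ((EuclideanSpace.equiv (Fin 3) ℝ : E3 →L[ℝ] R3).comp (ContinuousLinearMap.snd ℝ E4 E3)) r :=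
    (EuclideanSpace.equiv (Fin 3) ℝ : E3 →L[ℝ] R3).hasFDerivAt.comp r hasFDerivAt_snd
  have h3 : HasFDerivAt (fun r' : E4 × E3 ↦ T r'.1 (WithLp.ofLp r'.2))
      ((T r.1).comp ((EuclideanSpace.equiv (Fin 3) ℝ : E3 →L[ℝ] R3).comp
        (ContinuousLinearMap.snd ℝ E4 E3)) +
        ((fderiv ℝ T r.1).comp (ContinuousLinearMap.fst ℝ E4 E3)).flip (WithLp.ofLp r.2)) r :=
    h1.clm_apply h2
  have h4 : HasFDerivAt (fun r' : E4 × E3 ↦ WithLp.toLp 2 (T r'.1 (WithLp.ofLp r'.2)))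
      (((EuclideanSpace.equiv (Fin 3) ℝ).symm : R3 →L[ℝ] E3).comp
        ((T r.1).comp ((EuclideanSpace.equiv (Fin 3) ℝ : E3 →L[ℝ] R3).comp
          (ContinuousLinearMap.snd ℝ E4 E3)) +
          ((fderiv ℝ T r.1).comp (ContinuousLinearMap.fst ℝ E4 E3)).flip (WithLp.ofLp r.2))) r :=
    ((EuclideanSpace.equiv (Fin 3) ℝ).symm : R3 →L[ℝ] E3).hasFDerivAt.comp r h3
  have h5 := hasFDerivAt_fst.prodMk h4 (x := r)
  have heq : ((EuclideanSpace.equiv (Fin 3) ℝ).symm : R3 →L[ℝ] E3).comp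
        ((T r.1).comp ((EuclideanSpace.equiv (Fin 3) ℝ : E3 →L[ℝ] R3).comp
          (ContinuousLinearMap.snd ℝ E4 E3)) +
          ((fderiv ℝ T r.1).comp (ContinuousLinearMap.fst ℝ E4 E3)).flip (WithLp.ofLp r.2)) =
      ((EuclideanSpace.equiv (Fin 3) ℝ).symm : R3 →L[ℝ] E3).comp
        ((((fderiv ℝ T) r.1).flip (WithLp.ofLp r.2)).comp (ContinuousLinearMap.fst ℝ E4 E3) +
          (T r.1).comp ((EuclideanSpace.equiv (Fin 3) ℝ : E3 →L[ℝ] R3).comp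
            (ContinuousLinearMap.snd ℝ E4 E3))) := by
    refine ContinuousLinearMap.ext fun X ↦ ?_
    simp only [ContinuousLinearMap.comp_apply, _root_.add_apply, ContinuousLinearMap.flip_apply]
    rw [add_comm]
  rw [heq] at h5
  exact h5

/-- The differential of the transition map, evaluated:
`D(transMap)_{(q, η)} (u, w) = (u, (D_u T)(q) η + T(q) w)`. [folklore] -/
theorem fderiv_transMap_apply (hψ : ψ ∈ IsManifold.maximalAtlas (𝓡 4) ∞ M)
    (F₁ F₂ : TwistorFrame g o) (hF₁ : ψ.source ⊆ F₁.U) (hF₂ : ψ.source ⊆ F₂.U) {r : E4 × E3}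
    (hr : r.1 ∈ ψ.target) (X : E4 × E3) :
    fderiv ℝ (transMap hψ F₁ F₂) r X =
      (X.1, WithLp.toLp 2
        (fderiv ℝ (chartTrans (metricRepr g hψ) (fun a ↦ fieldRepr ψ (F₂.frame a))
            (fun a ↦ fieldRepr ψ (F₁.frame a))) r.1 X.1 (WithLp.ofLp r.2) +
          chartTrans (metricRepr g hψ) (fun a ↦ fieldRepr ψ (F₂.frame a))
            (fun a ↦ fieldRepr ψ (F₁.frame a)) r.1 (WithLp.ofLp X.2))) := by
  rw [(hasFDerivAt_transMap hψ F₁ F₂ hF₁ hF₂ hr).fderiv]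
  rfl

/-- The transition map is differentiable at the points over the chart target. [folklore] -/
theorem differentiableAt_transMap (hψ : ψ ∈ IsManifold.maximalAtlas (𝓡 4) ∞ M)
    (F₁ F₂ : TwistorFrame g o) (hF₁ : ψ.source ⊆ F₁.U) (hF₂ : ψ.source ⊆ F₂.U) {r : E4 × E3}
    (hr : r.1 ∈ ψ.target) : DifferentiableAt ℝ (transMap hψ F₁ F₂) r :=
  (hasFDerivAt_transMap hψ F₁ F₂ hF₁ hF₂ hr).differentiableAt

/-- **Gauge covariance of the model coupling forms of two frames** (the alternating-map form of
`modelScalar_gauge`): at `r = (q, η)` over the chart target,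
`Ω̂_{F₁}(r)(w₁, w₂) = Ω̂_{F₂}(transMap r)(D(transMap)_r w₁, D(transMap)_r w₂)`, i.e.
`Ω̂_{F₁} = (transMap)^* Ω̂_{F₂}` over `ψ.target × ℝ³`. [cite: FinePanov2009, Prop. 2.1] -/
theorem modelFormOf_transMap (hψ : ψ ∈ IsManifold.maximalAtlas (𝓡 4) ∞ M)
    (F₁ F₂ : TwistorFrame g o) (hF₁ : ψ.source ⊆ F₁.U) (hF₂ : ψ.source ⊆ F₂.U) {r : E4 × E3}
    (hr : r.1 ∈ ψ.target) (w : Fin 2 → E4 × E3) :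
    modelFormOf hψ F₂ (transMap hψ F₁ F₂ r) (fun i ↦ fderiv ℝ (transMap hψ F₁ F₂) r (w i)) =
      modelFormOf hψ F₁ r w := by
  obtain ⟨q, η⟩ := r
  have hG := metric_val_eq_repr g hψ
  have hvol : ∀ y : target ψ, ∃ vol : E4 [⋀^Fin 4]→ₗ[ℝ] ℝ,
      0 < vol (fun a ↦ fieldRepr ψ (F₂.frame a) y) * vol (fun a ↦ fieldRepr ψ (F₁.frame a) y) :=
    fun y ↦ exists_vol_pos_fieldRepr hψ o y (F₂.isPosFrame _ (hF₂ (ψ.map_target y.2)))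
      (F₁.isPosFrame _ (hF₁ (ψ.map_target y.2)))
  have key := modelScalar_gauge (ê := fun a ↦ fieldRepr ψ (F₂.frame a))
    (ê' := fun a ↦ fieldRepr ψ (F₁.frame a)) hG finrank_euclideanSpace_fin
    (contDiffOn_fieldRepr_frame hψ F₂ hF₂) (contDiffOn_fieldRepr_frame hψ F₁ hF₁)
    (isOrthonormalFrame_fieldRepr_frame hψ F₂ hF₂) (isOrthonormalFrame_fieldRepr_frame hψ F₁ hF₁)
    hvol ⟨q, hr⟩ η (w 0) (w 1)
  rw [modelFormOf_apply, modelFormOf_apply]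
  refine (modelForm_apply' _ _ _).trans ?_
  refine Eq.trans ?_ (modelForm_apply' _ _ _).symm
  simp only [fderiv_transMap_apply hψ F₁ F₂ hF₁ hF₂ hr, transMap_apply]
  exact key.symm

/-! ### Model-level identities: the antipodal map and vertical vectors -/

section Model

variable {E : Type*} [NormedAddCommGroup E] [NormedSpace ℝ E] [FiniteDimensional ℝ E]
  (c : E → E →L[ℝ] R3)

/-- **The model coupling form is odd under the fibrewise antipodal map**:
`Ω̂(y, -η)((u₁, -w₁), (u₂, -w₂)) = -Ω̂(y, η)((u₁, w₁), (u₂, w₂))` (`θ ↦ -θ`, `η ↦ -η`).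
[cite: FineKrasnovPanov2014, §4.1] -/
theorem modelForm_antipode (y : E) (η : E3) (w : Fin 2 → E × E3) :
    modelForm c (y, -η) (fun i ↦ ((w i).1, -(w i).2)) = -modelForm c (y, η) w := by
  rw [modelForm_apply', modelForm_apply']
  simp only [modelScalar, modelTheta, WithLp.ofLp_neg, map_neg, LinearMap.neg_apply, neg_neg,
    neg_dotProduct, dotProduct_neg, ← neg_add]
  ring

/-- **The model coupling form on vertical pairs** is `(2π)⁻¹ ⟨η, a × b⟩` (the area form of the
fibre sphere, outward normal, when `|η| = 1` and `a, b ⊥ η`). [cite: FinePanov2009, Prop. 2.1] -/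
theorem modelForm_vertical (y : E) (η a b : E3) :
    modelForm c (y, η) ![((0 : E), a), ((0 : E), b)] =
      (2 * Real.pi)⁻¹ * (WithLp.ofLp η ⬝ᵥ crossProduct (WithLp.ofLp a) (WithLp.ofLp b)) := by
  rw [modelForm_apply]
  simp only [modelScalar, modelTheta, modelCurv, map_zero, LinearMap.zero_apply, sub_zero,
    add_zero, dotProduct_zero, mul_zero]

end Model

end TwistorChart

end Literature.Geometry.Riemannian
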